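import Mathlib
import Summits.MatrixMultiplication.MatrixMultiplication.Theorems.LieRankDesigns.Negative.Basics
import Summits.MatrixMultiplication.MatrixMultiplication.Theorems.LevelGradedCohnUmansLieRankDesignsStubLevelFixedVector
import Summits.MatrixMultiplication.MatrixMultiplication.Theorems.LevelGradedCohnUmansLieRankDesignsStubFrameFnLevel
import Summits.MatrixMultiplication.MatrixMultiplication.Theorems.LevelGradedCohnUmansLieRankDesignsStubLevelOfFixedVector

/-!
# `LieRankDesigns` (stmt-MatrixMultiplication-7614), line `Sketch`: stub `stub_levelSetExact` — exact frame duality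

Crux `Summit.MatrixMultiplication.MatrixMultiplication.Theses.LevelGradedCohnUmans.LieRankDesigns`; skeleton
`Cruxes/LieRankDesigns/Lines/Sketch.lean` (lead prover-line-stmt-MatrixMultiplication-7614, registered stubs);
this file proves the registered stub `stub_levelSetExact` verbatim (name + signature) and lands
`--supports stmt-MatrixMultiplication-7614`.

Content (frame duality, both halves glued).  `G = GL_m(𝔽_p)` (`GLm p m`), `F_k = levelSet p m k` (the
functions `g ↦ Σ_M c_M ψ(tr(M g))` with `c` supported on matrices of rank `≤ k`), `H_k` the frame
stabiliser `{h | the first k columns of h are those of 1}` (inlined in the signature).  CLAIM: for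
`1 ≤ k ≤ m`, `Irr(G) ∩ F_k = Irr(G) ∩ {χ | Σ_{h ∈ H_k} χ(h) ≠ 0}` as sets of class functions.  Proof:
`Set.ext` and two inclusions — `⊆` is the landed stub A `stub_levelFixedVector` (an irreducible character
in `F_k` has an `H_k`-fixed vector, i.e. `Σ_{H_k} χ ≠ 0`), `⊇` is the landed stub L
`stub_levelOfFixedVector` fed with the landed stub K `stub_frameFnLevel` (every frame function
`g ↦ Σ_U φ U (g U)` lies in `F_k`, hence so does every irreducible character with an `H_k`-fixed vector).
This gives the EXACT graded budget `budget p m k s = Σ_{ρ : ρ^{H_k} ≠ 0} (dim ρ)^s` for every Lie line.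
-/

set_option linter.dupNamespace false

noncomputable section

open scoped BigOperators
open Literature.RepresentationTheory.FiniteGroups
open Summit.MatrixMultiplication.MatrixMultiplication.Theorems.LieRankDesigns.Negative
  (GLm Mat fourierFn RankSupp RankSep levelSet budget volume)

namespace Summit.MatrixMultiplication.MatrixMultiplication.Theorems.LieRankDesigns

/-- **Stub `LevelSetExact`** (registered signature; exact frame duality): for every prime `p` and
`1 ≤ k ≤ m`, the irreducible characters of `GL_m(𝔽_p)` lying in the level-`k` test space `F_k` are
exactly those with `Σ_{h ∈ H_k} χ(h) ≠ 0`, `H_k` the frame stabiliser (first `k` columns equal to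
those of `1`).  `⊆`: `stub_levelFixedVector` (A); `⊇`: `stub_levelOfFixedVector` (L) applied to
`stub_frameFnLevel` (K). -/
theorem stub_levelSetExact :
    ∀ (p m k : ℕ) [Fact p.Prime], 1 ≤ k → k ≤ m →
      irrChars (GLm p m) ∩ levelSet p m k =
        irrChars (GLm p m) ∩
          {χ | (∑ᶠ h ∈ {h : GLm p m | ∀ i j : Fin m, (i : ℕ) < k →
            (h : Mat p m) j i = (1 : Mat p m) j i}, χ h) ≠ 0} := by
  intro p m k _ hk hkm
  refine Set.ext fun χ => ⟨fun hχ => ⟨hχ.1, ?_⟩, fun hχ => ⟨hχ.1, ?_⟩⟩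
  · -- `⊆`: an irreducible character in `F_k` has `Σ_{H_k} χ ≠ 0` (stub A)
    exact stub_levelFixedVector p m k hk hkm χ hχ
  · -- `⊇`: `Σ_{H_k} χ ≠ 0` forces `χ ∈ F_k` (stub L fed with the frame functions of stub K)
    exact stub_levelOfFixedVector stub_frameFnLevel p m k hk hkm χ hχ.1 hχ.2

end Summit.MatrixMultiplication.MatrixMultiplication.Theorems.LieRankDesigns

end
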